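import Summits.CriticalPhenomena.PercolationContinuityZ3.Theorems.Transplant.BccPlanarSkeleton
import Summits.CriticalPhenomena.PercolationContinuityZ3.Theorems.Transplant.PlanarSkeletonConcDefs
import Literature.Barriers.CriticalPhenomena.SubexponentialGrowthZdProofs
import Mathlib.Tactic.FinCases
import Mathlib.Tactic.Ring
import HarnessLib

/-!
# The bcc lattice is an instance of the node-of-record interface `PlanarSkeletonConc` — (μ) bounded degree, (ι) outward skeleton steps,
# (κ) CONNECTED induced cylinders — hence `θ_{bcc}(p_c(bcc)) = 0` follows from the node of record `SamePDropOfSkeletonConcLt` ALONE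

builds on p205010 (kernel theorem, internal audit signed; external expert review pending).
Lane `prim-bschramm`, seat `prim-bschramm-p4` (gen 7; PART C3, class map — instances; lead ruling 22:39:18Z "bcc = p4-g7", fcc = p2-g5's
`CubicLatticesSkeletonConc`).  Helper file (`--supports stmt-CriticalPhenomena-4575 --as helper`).

The stmt seat's `bccSkeleton : PlanarSkeleton bccGraph` (`BccPlanarSkeleton`, rotated frame `φ = ((x₀+x₁)/2, (x₀−x₁)/2)`, translations, `D₄`)
is upgraded to **`bccSkeletonConc : PlanarSkeletonConc bccGraph`**:
* (μ) `Δ` from quasi-transitivity (`IsQuasiTransitive.exists_degree_le`);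
* (ι) `bcc_step`: the bond `x ↦ x + (σ, σ, 1)` moves `φ` by `σ e₀`, the bond `x ↦ x + (σ, −σ, 1)` by `σ e₁` (`bccSkel_addUnit`);
* (κ) **`bccCylGraph_connected` (`ℓ ≥ 1`)**: DESCENT ON `|x|²` inside the cylinder `φ⁻¹(Λ_ℓ)` — from every cylinder vertex `x ≠ 0` the bond
  `d_i = −1 if x_i > 0 else +1` leads to a cylinder vertex with `|x + d|² = |x|² − 2(|x₀|+|x₁|+|x₂|) + 3 < |x|²` (a non-zero bcc site has
  `|x₀|+|x₁|+|x₂| ≥ 2`: all coordinates odd, or all even and one of modulus `≥ 2`), and it stays in the cylinder because in the rotated frame the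
  bond moves `φ` by one unit TOWARDS the centre (or, at `x₀ = x₁ = 0`, to `φ = (1, 0)`, admissible since `ℓ ≥ 1`; for `ℓ = 0` the cylinder
  `{(0,0,2k)}` is edgeless, so `ℓ ≥ 1` is sharp);
* **`bccOwnCriticalContinuity_of_skeletonConcNode : SamePDropOfSkeletonConcLt → BccOwnCriticalContinuity`** (+ every vertex) via
  `continuity_of_skeletonConcLt_drop_amenable` (bcc connected, transitive, amenable, `p_c(bcc) < 1`, cylinders subcritical at every `p < 1` —
  all in the tree).  When the node of record lands as a theorem this is B–S Conjecture 4 for the body-centred cubic lattice, not in print.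
[cite: BenjaminiSchramm1996, Conj. 4] [cite: ConwaySloane1999, Ch. 1 §1.4 and Ch. 4 §7.1 (bcc = D₃*)] [cite: KozmaNitzan2024, §4 pp. 15–31]
-/

noncomputable section

namespace Summit.CriticalPhenomena.PercolationContinuityZ3.Theorems.Transplant

open MeasureTheory Literature.Probability.Percolation Literature.Probability.LatticeModels SimpleGraph
open Literature.Barriers.CriticalPhenomena (IsQuasiTransitive IsGraphAmenable)
open scoped Classical

namespace BccConc

/-! ## §1 Unit bonds: membership, adjacency, effect on the skeleton -/

/-- A vector with all coordinates `±1` keeps bcc sites bcc (it flips the common parity). [cite: ConwaySloane1999, Ch. 4 §7.1] -/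
theorem add_mem_bccSite {x d : Site 3} (hx : x ∈ bccSite) (hd : ∀ i, d i = 1 ∨ d i = -1) : x + d ∈ bccSite := by
  have hodd : ∀ i, Odd (d i) := fun i => by
    rcases hd i with h | h
    · rw [h]; exact odd_one
    · rw [h]; exact odd_neg_one
  rw [mem_bccSite_iff] at hx ⊢
  rcases hx with hx | hx
  · exact Or.inr fun i => (hx i).add_odd (hodd i)
  · exact Or.inl fun i => (hx i).add_odd (hodd i)

/-- A `(±1,±1,±1)`-bond is a bcc edge. [cite: ConwaySloane1999, Ch. 4 §7.1 (the eight neighbours (±1,±1,±1))] -/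
theorem bccGraph_adj_addUnit (x : bccSite) {d : Site 3} (hd : ∀ i, d i = 1 ∨ d i = -1) :
    bccGraph.Adj x ⟨(x : Site 3) + d, add_mem_bccSite x.2 hd⟩ := by
  rw [bccGraph_adj]
  refine ⟨fun h => ?_, ?_⟩
  · have h0 := congrFun h 0
    simp only [Pi.add_apply] at h0
    rcases hd 0 with h' | h' <;> rw [h'] at h0 <;> omega
  · have hsq : ∀ i, ((x : Site 3) i - ((x : Site 3) i + d i)) ^ 2 = 1 := fun i => by
      rcases hd i with h' | h' <;> rw [h'] <;> ring
    simp only [Fin.sum_univ_three, Pi.add_apply]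
    rw [hsq 0, hsq 1, hsq 2]; norm_num

/-- The step vector realising the skeleton step `σ e_i`: `(σ, σ, 1)` for `i = 0`, `(σ, −σ, 1)` for `i = 1`. [folklore] -/
def stepVec (i : Fin 2) (σ : ℤ) : Site 3 := ![σ, if i = 0 then σ else -σ, 1]

/-- The step vectors have coordinates `±1`. [folklore] -/
theorem stepVec_unit (i : Fin 2) {σ : ℤ} (hσ : σ = 1 ∨ σ = -1) (j : Fin 3) : stepVec i σ j = 1 ∨ stepVec i σ j = -1 := by
  fin_cases j
  · simpa [stepVec] using hσ
  · fin_cases i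
    · simpa [stepVec] using hσ
    · rcases hσ with rfl | rfl <;> simp [stepVec]
  · exact Or.inl rfl

/-- **(ι) the skeleton moves by `σ e_i` along the bond `stepVec i σ`.** [cite: ConwaySloane1999, Ch. 4 §7.1] -/
theorem bccSkel_addUnit (x : bccSite) (i : Fin 2) {σ : ℤ} (hσ : σ = 1 ∨ σ = -1) :
    bccSkel ⟨(x : Site 3) + stepVec i σ, add_mem_bccSite x.2 (stepVec_unit i hσ)⟩ = bccSkel x + Pi.single i σ := by
  set y : bccSite := ⟨(x : Site 3) + stepVec i σ, add_mem_bccSite x.2 (stepVec_unit i hσ)⟩ with hy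
  have hx0 := two_mul_bccSkel_zero x
  have hx1 := two_mul_bccSkel_one x
  have hy0 := two_mul_bccSkel_zero y
  have hy1 := two_mul_bccSkel_one y
  have ey0 : (y : Site 3) 0 = (x : Site 3) 0 + σ := rfl
  have ey1 : (y : Site 3) 1 = (x : Site 3) 1 + (if i = 0 then σ else -σ) := rfl
  ext j
  fin_cases i <;> fin_cases j <;> simp at ey1 ⊢ <;> omega

/-- **(ι) OUTWARD STEPS** at every vertex, for every axis and sign. [cite: KozmaNitzan2024, §4 p. 16] -/
theorem bcc_step (v : bccSite) (i : Fin 2) (σ : ℤˣ) : ∃ v' : bccSite, bccGraph.Adj v v' ∧ bccSkel v' = bccSkel v + Pi.single i (σ : ℤ) := by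
  have hσ : (σ : ℤ) = 1 ∨ (σ : ℤ) = -1 := by
    rcases Int.units_eq_one_or σ with rfl | rfl <;> simp
  exact ⟨_, bccGraph_adj_addUnit v (stepVec_unit i hσ), bccSkel_addUnit v i hσ⟩

/-! ## §2 (κ) the induced cylinders are connected: descent on `|x|²` -/

/-- The descent direction: `−1` on positive coordinates, `+1` otherwise. [folklore] -/
def descDir (x : Site 3) : Site 3 := fun i => if 0 < x i then -1 else 1

/-- The descent direction has coordinates `±1`. [folklore] -/
theorem descDir_unit (x : Site 3) (i : Fin 3) : descDir x i = 1 ∨ descDir x i = -1 := by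
  unfold descDir; split_ifs <;> simp

/-- One coordinate: `(a + d)² = a² − 2|a| + 1` for the descent direction `d`. [folklore] -/
theorem sq_add_descDir (x : Site 3) (i : Fin 3) : (x i + descDir x i) ^ 2 = x i ^ 2 - 2 * |x i| + 1 := by
  unfold descDir
  split_ifs with h
  · rw [abs_of_pos h]; ring
  · rw [abs_of_nonpos (not_lt.1 h)]; ring

/-- The squared norm `|x|² = x₀² + x₁² + x₂²`. [folklore] -/
def normSq (x : Site 3) : ℤ := x 0 ^ 2 + x 1 ^ 2 + x 2 ^ 2

/-- `|x|² = 0` only at the origin. [folklore] -/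
theorem eq_zero_of_normSq_le_zero {x : Site 3} (h : normSq x ≤ 0) : x = 0 := by
  unfold normSq at h
  have h0 : x 0 ^ 2 = 0 := by nlinarith [sq_nonneg (x 0), sq_nonneg (x 1), sq_nonneg (x 2)]
  have h1 : x 1 ^ 2 = 0 := by nlinarith [sq_nonneg (x 0), sq_nonneg (x 1), sq_nonneg (x 2)]
  have h2 : x 2 ^ 2 = 0 := by nlinarith [sq_nonneg (x 0), sq_nonneg (x 1), sq_nonneg (x 2)]
  ext i; fin_cases i
  · exact pow_eq_zero_iff (two_ne_zero) |>.1 h0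
  · exact pow_eq_zero_iff (two_ne_zero) |>.1 h1
  · exact pow_eq_zero_iff (two_ne_zero) |>.1 h2

/-- A non-zero bcc site has `|x₀| + |x₁| + |x₂| ≥ 2` (all coordinates odd, or all even with one of modulus `≥ 2`). [folklore] -/
theorem two_le_absSum_of_mem_bccSite {x : Site 3} (hx : x ∈ bccSite) (h0 : x ≠ 0) : 2 ≤ |x 0| + |x 1| + |x 2| := by
  rw [mem_bccSite_iff] at hx
  rcases hx with hx | hx
  · -- all even: some coordinate is a non-zero even number, of modulus ≥ 2
    obtain ⟨k0, hk0⟩ := hx 0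
    obtain ⟨k1, hk1⟩ := hx 1
    obtain ⟨k2, hk2⟩ := hx 2
    have ha0 := abs_nonneg (x 0)
    have ha1 := abs_nonneg (x 1)
    have ha2 := abs_nonneg (x 2)
    by_cases h0' : x 0 = 0
    · by_cases h1' : x 1 = 0
      · have h2' : x 2 ≠ 0 := by
          intro h2'
          apply h0
          ext i; fin_cases i
          · exact h0'
          · exact h1'
          · exact h2'
        have : 2 ≤ |x 2| := by rw [le_abs]; omega
        linarith
      · have : 2 ≤ |x 1| := by rw [le_abs]; omega
        linarith
    · have : 2 ≤ |x 0| := by rw [le_abs]; omega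
      linarith
  · obtain ⟨k0, hk0⟩ := hx 0
    obtain ⟨k1, hk1⟩ := hx 1
    obtain ⟨k2, hk2⟩ := hx 2
    have h0' : 1 ≤ |x 0| := by rw [le_abs]; omega
    have h1' : 1 ≤ |x 1| := by rw [le_abs]; omega
    have h2' : 1 ≤ |x 2| := by rw [le_abs]; omega
    linarith

/-- **The descent step decreases `|x|²`** on non-zero bcc sites. [folklore] -/
theorem normSq_add_descDir_lt {x : Site 3} (hx : x ∈ bccSite) (h0 : x ≠ 0) : normSq (x + descDir x) < normSq x := by
  have e : normSq (x + descDir x) = normSq x - 2 * (|x 0| + |x 1| + |x 2|) + 3 := by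
    unfold normSq
    simp only [Pi.add_apply]
    rw [sq_add_descDir x 0, sq_add_descDir x 1, sq_add_descDir x 2]
    ring
  have h2 := two_le_absSum_of_mem_bccSite hx h0
  linarith

/-- **The descent step stays in the cylinder** (`ℓ ≥ 1`): in the rotated frame it moves `φ` one unit towards the centre, or from the fibre axis
`x₀ = x₁ = 0` to `φ = (1, 0)`. [folklore] -/
theorem addDescDir_mem_bccCyl {ℓ : ℕ} (hℓ : 1 ≤ ℓ) {x : bccSite} (hx : x ∈ bccCyl ℓ) :
    (⟨(x : Site 3) + descDir x, add_mem_bccSite x.2 (descDir_unit x)⟩ : bccSite) ∈ bccCyl ℓ := by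
  set y : bccSite := ⟨(x : Site 3) + descDir x, add_mem_bccSite x.2 (descDir_unit x)⟩ with hy
  have hx0 := two_mul_bccSkel_zero x
  have hx1 := two_mul_bccSkel_one x
  have hy0 := two_mul_bccSkel_zero y
  have hy1 := two_mul_bccSkel_one y
  have ey0 : (y : Site 3) 0 = (x : Site 3) 0 + descDir x 0 := rfl
  have ey1 : (y : Site 3) 1 = (x : Site 3) 1 + descDir x 1 := rfl
  simp only [bccCyl, Set.mem_setOf_eq, mem_box, Fin.forall_fin_two] at hx ⊢
  unfold descDir at ey0 ey1
  split_ifs at ey0 ey1 <;> omega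

/-- **DESCENT**: every non-zero cylinder vertex has a cylinder neighbour of smaller `|x|²` (`ℓ ≥ 1`). [folklore] -/
theorem bccCyl_descent {ℓ : ℕ} (hℓ : 1 ≤ ℓ) {x : bccSite} (hx : x ∈ bccCyl ℓ) (h0 : (x : Site 3) ≠ 0) :
    ∃ y : bccSite, ∃ hy : y ∈ bccCyl ℓ, (bccCylGraph ℓ).Adj ⟨x, hx⟩ ⟨y, hy⟩ ∧ normSq (y : Site 3) < normSq (x : Site 3) :=
  ⟨_, addDescDir_mem_bccCyl hℓ hx, bccGraph_adj_addUnit x (descDir_unit x), normSq_add_descDir_lt x.2 h0⟩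

/-- **Every cylinder vertex is joined to the origin inside the cylinder** (`ℓ ≥ 1`; strong induction on `|x|²`). [folklore] -/
theorem bccCyl_reachable_origin {ℓ : ℕ} (hℓ : 1 ≤ ℓ) :
    ∀ (n : ℕ) (x : bccSite) (hx : x ∈ bccCyl ℓ), normSq (x : Site 3) ≤ n →
      (bccCylGraph ℓ).Reachable ⟨x, hx⟩ ⟨bccOrigin, bccOrigin_mem_bccCyl ℓ⟩ := by
  intro n
  induction n with
  | zero =>
    intro x hx hn
    have hx0 : (x : Site 3) = 0 := eq_zero_of_normSq_le_zero (by exact_mod_cast hn)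
    have : x = bccOrigin := Subtype.ext hx0
    subst this
    rfl
  | succ n ih =>
    intro x hx hn
    by_cases hx0 : (x : Site 3) = 0
    · have : x = bccOrigin := Subtype.ext hx0
      subst this
      rfl
    · obtain ⟨y, hy, hadj, hlt⟩ := bccCyl_descent hℓ hx hx0
      have hyn : normSq (y : Site 3) ≤ n := by
        have : normSq (y : Site 3) < (n : ℤ) + 1 := lt_of_lt_of_le hlt (by exact_mod_cast hn)
        omega
      exact hadj.reachable.trans (ih y hy hyn)

/-- **(κ) the induced bcc cylinder `φ⁻¹(Λ_ℓ)` is connected for `ℓ ≥ 1`** (for `ℓ = 0` it is the edgeless set `{(0,0,2k)}`).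
[cite: KozmaNitzan2024, §4 p. 17 (subboxes)] -/
theorem bccCylGraph_connected {ℓ : ℕ} (hℓ : 1 ≤ ℓ) : (bccCylGraph ℓ).Connected := by
  haveI : Nonempty (bccCyl ℓ) := ⟨⟨bccOrigin, bccOrigin_mem_bccCyl ℓ⟩⟩
  refine ⟨fun x y => ?_⟩
  have hx := bccCyl_reachable_origin hℓ (normSq (x.1 : Site 3)).toNat x.1 x.2 (Int.self_le_toNat _)
  have hy := bccCyl_reachable_origin hℓ (normSq (y.1 : Site 3)).toNat y.1 y.2 (Int.self_le_toNat _)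
  exact hx.trans hy.symm

end BccConc

/-! ## §3 The `PlanarSkeletonConc` structure and the conditional theorem -/

/-- The bcc lattice is quasi-transitive (transitive). [cite: BenjaminiSchramm1996, §2] -/
theorem bcc_isQuasiTransitive : IsQuasiTransitive bccGraph :=
  isQuasiTransitive_of_isPretransitive bccGraph bccOrigin isPretransitive_aut_bcc

/-- **The bcc lattice is a `PlanarSkeletonConc`**: `bccSkeleton` (rotated frame, translations, `D₄`) + (μ) bounded degree + (ι) outward steps +
(κ) connected induced cylinders. [cite: KozmaNitzan2024, §4 pp. 15–17] [cite: ConwaySloane1999, Ch. 4 §7.1] -/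
def bccSkeletonConc : PlanarSkeletonConc bccGraph :=
  { bccSkeleton with
    Δ := bcc_isQuasiTransitive.exists_degree_le.choose
    degree_le := bcc_isQuasiTransitive.exists_degree_le.choose_spec
    step := fun v i σ => BccConc.bcc_step v i σ
    cyl_connected := fun t ht ℓ hℓ => by
      have ht' : t = bccOrigin := by simpa [bccSkeleton] using ht
      subst ht'
      have hset : {w : bccSite | bccSkeleton.φ w - bccSkeleton.φ bccOrigin ∈ box 2 ℓ} = bccCyl ℓ := by
        ext w; simp [bccCyl]
      rw [hset]
      exact BccConc.bccCylGraph_connected hℓ }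

/-- The underlying planar skeleton is `bccSkeleton`. [folklore] -/
@[simp] theorem bccSkeletonConc_toPlanarSkeleton : bccSkeletonConc.toPlanarSkeleton = bccSkeleton := rfl

/-- **The bcc target closes MODULO THE NODE OF RECORD**: `SamePDropOfSkeletonConcLt → θ_{bcc}(p_c(bcc)) = 0` — bcc connected, transitive,
amenable (Burton–Keane uniqueness in the tree), `p_c(bcc) < 1`, cylinders subcritical at every `p < 1`; builds on p205010 (kernel theorem,
internal audit signed; external expert review pending). [cite: BenjaminiSchramm1996, Conj. 4] [cite: KozmaNitzan2024, §1 p. 2 (approach 1), §4] -/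
theorem bccOwnCriticalContinuity_of_skeletonConcNode (hD : SamePDropOfSkeletonConcLt) : BccOwnCriticalContinuity :=
  continuity_of_skeletonConcLt_drop_amenable hD bccGraph bccSkeletonConc bccGraph_connected bcc_isQuasiTransitive bcc_isGraphAmenable
    bccOrigin (Finset.mem_singleton_self _) criticalProb_bcc_lt_one bccSkeleton_cylSubcritical_criticalProb

/-- … at every vertex of the bcc lattice (vertex-transitivity). [cite: BenjaminiSchramm1996, Conj. 4] -/
theorem bcc_criticalContinuity_of_skeletonConcNode (hD : SamePDropOfSkeletonConcLt) (v : bccSite) :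
    theta bccGraph v (criticalProbIOf bccGraph v) = 0 := by
  haveI : Countable bccSite := inferInstance
  have hθ := theta_iso (distSqGraphShiftIso 3 3 bccSubgroup v) bccOrigin (criticalProbIOf bccGraph bccOrigin)
  have hpc := criticalProb_iso (distSqGraphShiftIso 3 3 bccSubgroup v) bccOrigin
  rw [distSqGraphShiftIso_bccOrigin] at hθ hpc
  have e : criticalProbIOf bccGraph v = criticalProbIOf bccGraph bccOrigin := Subtype.ext hpc
  have h0 : theta bccGraph bccOrigin (criticalProbIOf bccGraph bccOrigin) = 0 := bccOwnCriticalContinuity_of_skeletonConcNode hD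
  rw [e]
  exact hθ.trans h0

end Summit.CriticalPhenomena.PercolationContinuityZ3.Theorems.Transplant

end
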